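import Mathlib
import HarnessLib
import HarnessLib.Audit
import Summits.ValiantsHypothesis.ValiantsHypothesis.Theorems.LacunarySymmetroidMatrixDescartesZeroChangeConcavityBudgetDip
import Summits.ValiantsHypothesis.ValiantsHypothesis.Theorems.LacunarySymmetroidMatrixDescartesZeroChangeValleyBottoms

/-!
# ValiantsHypothesis / LacunarySymmetroid — crux `MatrixDescartes` (stmt-ValiantsHypothesis-18050, V1), LINE (A) «product_plus_one»,
# research stubs `stub_classRowK3` / `stub_eulerBoundK3`: the DIP BUDGET of a ZERO-FREE company (valley residue) —
# `posCrit ≤ 2·#DIPS + 1`, the dip criterion in Pick-sum currency, and the located linear law `V(2m+1) ⟸ #DIPS ≤ m`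

Fourth panel of the valley-residue series (✓ `…ZeroChangeValleyBottoms` bottom brackets / localisation / common-bottom law;
✓ `…ProductPlusOneEulerMiddleOuterRatio`, ⧗ `…ProductPlusOneEulerTopBottomRatio`: middle / top couplings).  For a company
`Φ = ∏_j g_j`, `g_j = p_j + q_jX^a + s_jX^c` (`0 < a < c`) that is ZERO-FREE on `(0,∞)` (e.g. zero-change rows and zero-free two-change
VALLEY rows `(+,−,+)`), the abstract dip budget ✓ `ZeroChange.posCrit_le_dipBudget` loses its root term:

* ★ `posCrit_le_two_mul_dips_add_one_of_zeroFree` — `posCrit Φ ≤ 2·#DIPS + 1`, DIPS = `{t > 0 : Φ′(t) = 0, Φ(t)·Φ″(t) ≥ 0}` (the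
  non-maxima; between two strict local maxima of a zero-free `Φ` sits a dip);
* `dip_iff_sq_sum_le` — **DIP CRITERION** (✓ `ZeroChange.concavity_identity` read on the valley side): at a positive critical point off
  the roots, `Φ(t)Φ″(t) ≥ 0 ⟺ Σ_j h_j(t)² ≤ a(a−c)·M(t)`, `h_j = t g_j′/g_j`, `M` the middle Pick sum ✓ `middleSum` (for valley rows
  `M < 0`, so the right side is `a(c−a)|M| = c(c−a)T > 0` by ✓ `critical_relation`: dips are the critical points at which the rows'
  θ-log-derivatives are jointly SMALL against the top Pick sum);
* ★ `posCrit_le_two_mul_sqDips_add_one_of_zeroFree` — the budget with DIPS written in that currency;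
* `euler_bottom_le_two_mul_dips_add_one` — Euler currency (`Z₊(eulerNumerator d a 0)`, unfolded), every support `d₀ < d₁ < d₂`;
* ★ `valleyLinearLaw_of_dipBudget` — **THE LOCATED LINEAR LAW AS AN IMPLICATION**: a dip budget `#DIPS ≤ m` for zero-free companies with
  positive top letters gives `posCrit Φ ≤ 2m + 1` (and `Z₊(eulerNumerator d a 0) ≤ 2m + 1`) for all of them — the exact shape in which
  ✓ `oneChangeFloorK3_of_badBudget` records the floor's residual.

LOCATED, NOT PROVED (this seat; exact sign counts of `Σ_j β_j/g_j` on log-grids, random zero-free valley/zero-change companies `m ≤ 6`,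
ratio `c : a ∈ {1.3,…,17}`, plus a hill-climb at `m = 3`; files `work/probe/valley_*.py` of the seat folder): `#DIPS ≤ m` with NO violation
(3 000 + 6 000 companies), total `posCrit ≤ 2m − 1`, both attained by scale-separated deep valleys (`m` dips, `m − 1` maxima); Descartes on
`θΦ` allows `Θ(m²)` sign changes there (coefficient of `x^{ia+jc}` has sign `(−1)^i`).  OPEN (the remaining lemma of this cell, size M):
`valley_dips_le_m : #DIPS ≤ m` for zero-free companies with positive top letters.

HONEST FRAMING: helper / bookkeeping theorems, def-free, no named facts, no `sorry`, standard axioms; closes NO stub by name;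
`OneChangeFloorK3`, `EulerBoundK3`, `ClassRowK3Linear`, `PPOPolyLaw`, `MatrixDescartes` (stmt-ValiantsHypothesis-18050) stay OPEN;
`VP ≠ VNP` is NOT proved and nothing here bears on it.  [folklore] Rolle-type bookkeeping; no citation needed.
-/

set_option linter.dupNamespace false

namespace Summit.ValiantsHypothesis.ValiantsHypothesis.Theorems.LacunarySymmetroidMatrixDescartes

namespace ZeroChange

open Polynomial Finset

/-! ## §1 Zero-free companies: the root term of the dip budget vanishes -/

/-- A company whose rows are positive on `(0,∞)` has no positive root. [folklore] -/
theorem posRoots_prod_rows_eq_empty_of_zeroFree (m a c : ℕ) (co : Fin m → ℝ × ℝ × ℝ)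
    (hpos : ∀ j, ∀ t : ℝ, 0 < t → 0 < (row a c (co j).1 (co j).2.1 (co j).2.2).eval t) :
    ((∏ j, row a c (co j).1 (co j).2.1 (co j).2.2).roots.toFinset.filter (fun t => 0 < t)) = ∅ := by
  classical
  refine filter_false_of_mem fun t ht => ?_
  intro ht0
  rw [Multiset.mem_toFinset] at ht
  have hev : (∏ j, row a c (co j).1 (co j).2.1 (co j).2.2).eval t = 0 := (mem_roots'.1 ht).2
  rw [eval_prod] at hev
  exact (prod_pos fun j _ => hpos j t ht0).ne' hev

/-- ★ **DIP BUDGET OF A ZERO-FREE COMPANY**: `posCrit Φ ≤ 2·#{t > 0 : Φ′(t) = 0, Φ(t)Φ″(t) ≥ 0} + 1`. [folklore] -/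
theorem posCrit_le_two_mul_dips_add_one_of_zeroFree (m a c : ℕ) (co : Fin m → ℝ × ℝ × ℝ)
    (hpos : ∀ j, ∀ t : ℝ, 0 < t → 0 < (row a c (co j).1 (co j).2.1 (co j).2.2).eval t) :
    posCrit (∏ j, row a c (co j).1 (co j).2.1 (co j).2.2) ≤
      2 * (((derivative (∏ j, row a c (co j).1 (co j).2.1 (co j).2.2)).roots.toFinset.filter (fun t => 0 < t)).filter
          (fun t => 0 ≤ (∏ j, row a c (co j).1 (co j).2.1 (co j).2.2).eval t *
            (derivative (derivative (∏ j, row a c (co j).1 (co j).2.1 (co j).2.2))).eval t)).card + 1 := by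
  classical
  have h := posCrit_le_dipBudget (∏ j, row a c (co j).1 (co j).2.1 (co j).2.2)
  rw [posRoots_prod_rows_eq_empty_of_zeroFree m a c co hpos, card_empty, mul_zero, add_zero] at h
  refine h.trans ?_
  gcongr 2 * ?_ + 1
  refine card_le_card (fun t ht => ?_)
  simp only [mem_filter] at ht ⊢
  exact ⟨ht.1, ht.2.2⟩

/-! ## §2 The dip criterion in Pick-sum currency -/

/-- **DIP CRITERION**: at a positive critical point `t` off the roots, `Φ(t)Φ″(t) ≥ 0` iff
`Σ_j (t g_j′(t)/g_j(t))² ≤ a(a−c)·M(t)` (✓ `concavity_identity`). [folklore] -/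
theorem dip_iff_sq_sum_le (m a c : ℕ) (co : Fin m → ℝ × ℝ × ℝ) {t : ℝ} (ht : 0 < t)
    (hΦ : (∏ j, row a c (co j).1 (co j).2.1 (co j).2.2).eval t ≠ 0)
    (hcrit : (derivative (∏ j, row a c (co j).1 (co j).2.1 (co j).2.2)).eval t = 0) :
    0 ≤ (∏ j, row a c (co j).1 (co j).2.1 (co j).2.2).eval t *
        (derivative (derivative (∏ j, row a c (co j).1 (co j).2.1 (co j).2.2))).eval t ↔
      ∑ j, (t * (derivative (row a c (co j).1 (co j).2.1 (co j).2.2)).eval t /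
          (row a c (co j).1 (co j).2.1 (co j).2.2).eval t) ^ 2 ≤ (a : ℝ) * ((a : ℝ) - c) * middleSum a c co t := by
  have hid := concavity_identity m a c co ht hΦ hcrit
  have ht2 : 0 < t ^ 2 := by positivity
  have hΦ2 : 0 < ((∏ j, row a c (co j).1 (co j).2.1 (co j).2.2).eval t) ^ 2 := by positivity
  constructor
  · intro h
    have h1 : 0 ≤ t ^ 2 * ((∏ j, row a c (co j).1 (co j).2.1 (co j).2.2).eval t *
        (derivative (derivative (∏ j, row a c (co j).1 (co j).2.1 (co j).2.2))).eval t) := mul_nonneg ht2.le h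
    rw [hid] at h1
    nlinarith
  · intro h
    have h1 : 0 ≤ ((∏ j, row a c (co j).1 (co j).2.1 (co j).2.2).eval t) ^ 2 *
        ((a : ℝ) * ((a : ℝ) - c) * middleSum a c co t -
          ∑ j, (t * (derivative (row a c (co j).1 (co j).2.1 (co j).2.2)).eval t /
            (row a c (co j).1 (co j).2.1 (co j).2.2).eval t) ^ 2) := mul_nonneg hΦ2.le (by linarith)
    rw [← hid] at h1
    by_contra hneg
    push Not at hneg
    linarith [mul_neg_of_pos_of_neg ht2 hneg]

/-- ★ **DIP BUDGET IN PICK-SUM CURRENCY** (zero-free company): `posCrit Φ ≤ 2·#{t > 0 : Φ′(t) = 0, Σ_j h_j(t)² ≤ a(a−c)M(t)} + 1`. [folklore] -/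
theorem posCrit_le_two_mul_sqDips_add_one_of_zeroFree (m a c : ℕ) (co : Fin m → ℝ × ℝ × ℝ)
    (hpos : ∀ j, ∀ t : ℝ, 0 < t → 0 < (row a c (co j).1 (co j).2.1 (co j).2.2).eval t) :
    posCrit (∏ j, row a c (co j).1 (co j).2.1 (co j).2.2) ≤
      2 * (((derivative (∏ j, row a c (co j).1 (co j).2.1 (co j).2.2)).roots.toFinset.filter (fun t => 0 < t)).filter
          (fun t => ∑ j, (t * (derivative (row a c (co j).1 (co j).2.1 (co j).2.2)).eval t /
            (row a c (co j).1 (co j).2.1 (co j).2.2).eval t) ^ 2 ≤ (a : ℝ) * ((a : ℝ) - c) * middleSum a c co t)).card + 1 := by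
  classical
  refine (posCrit_le_two_mul_dips_add_one_of_zeroFree m a c co hpos).trans (le_of_eq ?_)
  congr 2
  refine congrArg Finset.card (filter_congr fun t ht => ?_)
  simp only [mem_filter, Multiset.mem_toFinset] at ht
  obtain ⟨hroot, ht0⟩ := ht
  have hcrit : (derivative (∏ j, row a c (co j).1 (co j).2.1 (co j).2.2)).eval t = 0 := (mem_roots'.1 hroot).2
  have hΦ : (∏ j, row a c (co j).1 (co j).2.1 (co j).2.2).eval t ≠ 0 := by
    rw [eval_prod]
    exact (prod_pos fun j _ => hpos j t ht0).ne'
  exact dip_iff_sq_sum_le m a c co ht0 hΦ hcrit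

/-! ## §3 Euler currency and the located linear law as an implication -/

/-- **DIP BUDGET IN EULER CURRENCY**: on a support `d₀ < d₁ < d₂`, a company zero-free on `(0,∞)` has
`Z₊(eulerNumerator d a 0) ≤ 2·#DIPS + 1`. [folklore] -/
theorem euler_bottom_le_two_mul_dips_add_one {m : ℕ} (d : Fin 3 → ℕ) (h01 : d 0 < d 1) (h12 : d 1 < d 2)
    (a : Fin m → Fin 3 → ℝ) (hpos : ∀ j, ∀ t : ℝ, 0 < t → 0 < (row (d 1 - d 0) (d 2 - d 0) (a j 0) (a j 1) (a j 2)).eval t) :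
    ((∑ j, (∑ l, C (a j l * ((d l : ℝ) - d 0)) * X ^ (d l)) * ∏ i ∈ Finset.univ.erase j, (∑ l, C (a i l) * X ^ (d l))
        : ℝ[X]).roots.toFinset.filter (fun t => 0 < t)).card ≤
      2 * (((derivative (∏ j, row (d 1 - d 0) (d 2 - d 0) (a j 0) (a j 1) (a j 2))).roots.toFinset.filter
          (fun t => 0 < t)).filter
          (fun t => 0 ≤ (∏ j, row (d 1 - d 0) (d 2 - d 0) (a j 0) (a j 1) (a j 2)).eval t *
            (derivative (derivative (∏ j, row (d 1 - d 0) (d 2 - d 0) (a j 0) (a j 1) (a j 2)))).eval t)).card + 1 := by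
  rw [card_posRoots_euler_bottom_eq_posCrit d h01.le (h01.le.trans h12.le) a]
  exact posCrit_le_two_mul_dips_add_one_of_zeroFree m (d 1 - d 0) (d 2 - d 0) (fun j => (a j 0, a j 1, a j 2)) hpos

/-- ★ **THE LOCATED LINEAR LAW OF THE VALLEY RESIDUE AS AN IMPLICATION**: if every zero-free company with positive top letters on
`0 < a < c` has at most `m` dips, then every such company has at most `2m + 1` positive critical points. [folklore] -/
theorem valleyLinearLaw_of_dipBudget
    (hdip : ∀ (m a c : ℕ), 0 < a → a < c → ∀ (co : Fin m → ℝ × ℝ × ℝ), (∀ j, 0 < (co j).2.2) →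
      (∀ j, ∀ t : ℝ, 0 < t → 0 < (row a c (co j).1 (co j).2.1 (co j).2.2).eval t) →
      (((derivative (∏ j, row a c (co j).1 (co j).2.1 (co j).2.2)).roots.toFinset.filter (fun t => 0 < t)).filter
          (fun t => 0 ≤ (∏ j, row a c (co j).1 (co j).2.1 (co j).2.2).eval t *
            (derivative (derivative (∏ j, row a c (co j).1 (co j).2.1 (co j).2.2))).eval t)).card ≤ m)
    (m a c : ℕ) (ha : 0 < a) (hac : a < c) (co : Fin m → ℝ × ℝ × ℝ) (htop : ∀ j, 0 < (co j).2.2)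
    (hpos : ∀ j, ∀ t : ℝ, 0 < t → 0 < (row a c (co j).1 (co j).2.1 (co j).2.2).eval t) :
    posCrit (∏ j, row a c (co j).1 (co j).2.1 (co j).2.2) ≤ 2 * m + 1 := by
  have h1 := posCrit_le_two_mul_dips_add_one_of_zeroFree m a c co hpos
  have h2 := hdip m a c ha hac co htop hpos
  omega

/-- The same implication in EULER CURRENCY on every support `d₀ < d₁ < d₂`: a dip budget `#DIPS ≤ m` gives
`Z₊(eulerNumerator d a 0) ≤ 2m + 1` for zero-free companies with positive top letters — the valley-residue row of `EulerBoundK3`'s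
bottom-coupling column with constant `2`. [folklore] -/
theorem euler_bottom_valleyLinearLaw_of_dipBudget
    (hdip : ∀ (m a c : ℕ), 0 < a → a < c → ∀ (co : Fin m → ℝ × ℝ × ℝ), (∀ j, 0 < (co j).2.2) →
      (∀ j, ∀ t : ℝ, 0 < t → 0 < (row a c (co j).1 (co j).2.1 (co j).2.2).eval t) →
      (((derivative (∏ j, row a c (co j).1 (co j).2.1 (co j).2.2)).roots.toFinset.filter (fun t => 0 < t)).filter
          (fun t => 0 ≤ (∏ j, row a c (co j).1 (co j).2.1 (co j).2.2).eval t *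
            (derivative (derivative (∏ j, row a c (co j).1 (co j).2.1 (co j).2.2))).eval t)).card ≤ m)
    {m : ℕ} (d : Fin 3 → ℕ) (h01 : d 0 < d 1) (h12 : d 1 < d 2) (a : Fin m → Fin 3 → ℝ) (htop : ∀ j, 0 < a j 2)
    (hpos : ∀ j, ∀ t : ℝ, 0 < t → 0 < (row (d 1 - d 0) (d 2 - d 0) (a j 0) (a j 1) (a j 2)).eval t) :
    ((∑ j, (∑ l, C (a j l * ((d l : ℝ) - d 0)) * X ^ (d l)) * ∏ i ∈ Finset.univ.erase j, (∑ l, C (a i l) * X ^ (d l))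
        : ℝ[X]).roots.toFinset.filter (fun t => 0 < t)).card ≤ 2 * m + 1 := by
  rw [card_posRoots_euler_bottom_eq_posCrit d h01.le (h01.le.trans h12.le) a]
  exact valleyLinearLaw_of_dipBudget hdip m (d 1 - d 0) (d 2 - d 0) (by omega) (by omega) (fun j => (a j 0, a j 1, a j 2))
    htop hpos

end ZeroChange

end Summit.ValiantsHypothesis.ValiantsHypothesis.Theorems.LacunarySymmetroidMatrixDescartes

/-! ## Correction to the LOCATED paragraph of the header (same seat, later numerics; nothing kernel-level changes)

The located count `posCrit ≤ 2m − 1` quoted in the header was measured on PURE valley companies (every `q_j < 0`) and holds there in all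
samples.  For MIXED zero-free companies (`k` valley rows with `q_j < 0` plus `m − k ≥ 1` zero-change rows with `q_j ≥ 0`, all `s_j > 0`) the
seat's later numerics (11 000 companies, ratios `1.3 … 9`) give instead `#DIPS ≤ min(m, k+1)` and `posCrit ≤ 2·min(m, k+1)`, both ATTAINED
(`m = 3, k = 2`: six critical points `> 2m − 1`): with a zero-change row present `Σ_j t g_j′/g_j` may be positive near `0⁺`, the first critical
point may be a local maximum, and the count is then even.  The dip bound `#DIPS ≤ m` used as the hypothesis of
`valleyLinearLaw_of_dipBudget` / `euler_bottom_valleyLinearLaw_of_dipBudget` had NO violation in any sample (pure or mixed), so the typed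
implication and its conclusion `posCrit ≤ 2m + 1` remain the located target as stated.  Evidence: NOTE-leafhand-lacsym7-g1-valley-residue.md
(rev 5) on stmt-ValiantsHypothesis-18050. -/
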